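import Summits.CriticalPhenomena.PercolationContinuityZ3.Theorems.PercNearOneGluingNoHeavyLowerTailSahiCubeNonAbsorbing

/-!
# `NoHeavyLowerTail` (stmt-CriticalPhenomena-4575) — Sahi's `E_6 ≥ 0` on the non-absorbing sextuples of up-sets of `{0,1}^4`, row A
# (kernel evaluation of the six-copy digit test)

Support file, seat `prim-l12-p5` (gen 5), `--supports stmt-CriticalPhenomena-4575`, COMPUTATIONAL (`native_decide`, like
`SahiHereditaryMeetAbsorption.checkNA_four`).  One ROW of the order-6 residual check of `…SahiCubeNonAbsorbing` on the four-dimensional cube: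
first bitmask ≤ 61162 (2 048 non-absorbing sextuples); digit base `2^35` (`coefBound 4 6 = 12 079 595 520 < 2^34`), positions in base `7`,
Kronecker numbers of the 168 increasing bitmasks from the table `ktTab 35 7 4`.  Over both rows the digit test runs on exactly the 4 096 non-absorbing
sextuples `(↑({2-subsets} ∖ {x_j}) ∪ S_j)_j` (seat pre-check `code/e56_kron.py`: all 9.8 M fibre sums `≥ 0`, max `357 888`).  Nothing else is asserted;
assembled in `…SahiConjectureCubeFour`.
-/

namespace Summit.CriticalPhenomena.PercolationContinuityZ3.Theorems.NCopyCert

open SahiC3Cube OneCutCert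

/-- **Row A of the order-6 residual check on `{0,1}^4`** (first bitmask ≤ 61162 (2 048 non-absorbing sextuples)): every sorted sextuple of increasing bitmasks in the row
has an absorbing prefix or passes the six-copy digit test. [this file] -/
theorem checkR6W_cube_four_rowA :
    checkR6W 4 (ktLook 35 7 4 (ktTab 35 7 4)) (krTB 35 7 4 (fullN 4)) (maskN 35 (7 ^ 4)) (maskN 35 (7 ^ 4))
      (fun a => decide (a ≤ 61162)) = true := by
  native_decide

end Summit.CriticalPhenomena.PercolationContinuityZ3.Theorems.NCopyCert
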